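import Summits.BirchSwinnertonDyer.BirchSwinnertonDyer.Theorems.CountingDoorF2AtThreeRootNumberClosedForm
import HarnessLib

/-!
# BirchSwinnertonDyer / CountingDoorF2AtThree — crux I2 `RootNumberPlusLowerDensityLargeF2`
# (stmt-BirchSwinnertonDyer-19441), lane «closed-form local root numbers»: the Jacobi kernel of the root
# number of `F₂` is «TYPE I» — a real character at the LINEAR form `c₄ = a₁⁴ + 48Q − 24a₁a₃` in `a₃`
# (generic class, kernel-checked)

Companion of `…RootNumberClosedForm.lean` (§4 there: on the squarefree locus `w(E_a) = −μ(m)·J(−c₆(a) | m)`,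
`m` the odd part of `|Δ(a)|`, modulo Modularity). The ideation census of the crux (561570aeecec, §1) and lane B's
census rest on the sentence «the Jacobi kernel `J(−c₆(a) | m)` is Type I: a quadratic character of modulus
`G(a₁,a₂,a₂′)` at `c₄(a)`, which is linear in `a₃`, times a pliable factor» — until now a hand computation. This
file proves it for the GENERIC class `gcd(a₁, 6) = 1`, `gcd(a₁, Q) = 1` (`Q = a₂² + a₂a₂′ + a₂′²`), with the
pliable factor explicit:

* `jacobiSym_neg_transfer` — abstract transfer lemma: for integers with `1728Δ = c₄³ − c₆²`, `c₄ ∣ 8a₁²c₆ − G`,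
  `|Δ| = 2^v M` (`M` odd), `c₄ ≡ 1 (8)`, `c₆` odd and prime to `3`, `G` odd, `gcd(a₁, c₄) = 1`:
  `J(−c₆ | M) = ε · J(c₄ | |G|)` with `ε` an explicit product of `qrSign`'s, `χ₈(|c₆|)^v`, `J(±1 | ·)`'s and
  `J(3 | |c₆|)` — three quadratic reciprocities (`M ↔ |c₆|`, `|c₆| ↔ |c₄|`, `|c₄| ↔ |G|`).
* `eight_mul_a₁_sq_mul_c₆` — the exact identity **`8a₁²·c₆(a) = G(a) + 9·c₄(a)·(8a₁a₃ − a₁⁴ + 16Q)`** for `F₂`,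
  `G = a₁⁸ − 288a₁⁴Q − 6912a₁²R − 6912Q²` (`R = a₂a₂′(a₂ + a₂′)`): `c₆ ≡ G/(8a₁²) (mod c₄)` with no denominator.
* `jacobiSym_neg_c₆_eq_typeI` — for `a ∈ F₂` with `a₁` odd, `3 ∤ a₁`, `gcd(a₁, Q) = 1` and `|Δ(a)| = 2^v M`, `M` odd:
  `J(−c₆(a) | M) = ε(a) · J(c₄(a) | |G(a₁,a₂,a₂′)|)`; since `G` does not involve `a₃` and `c₄` is linear in `a₃`,
  this is the «Type I» structure.
* `rootNumber_curve_eq_typeI_of_odd` / `_of_even` — on the squarefree locus (generic class), modulo Modularity: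
  **`w(E_a) = −μ(m) · ε(a) · J(c₄(a) | |G|)`**.

Numerical certificate before typing (kit j281807, lane B GEN 2): the displayed normal form agrees with PARI's
`ellrootno`-derived kernel on 3 329 798 / 3 329 798 squarefree generic members. HONEST STATUS: this is structure of
the SIGN FUNCTION only; the crux (a `2/3`-bias bound for `μ(m_a)·ε(a)·J(c₄(a) | |G|)` over a congruence class — weak
Chowla for an irreducible quaternary form twisted by a real character at a linear form) stays OPEN; Type-I data are
parity-blind. No S0 motion. PARTITION: none — r_an ≥ 2, summit axis S0; TWIN (D-0056): n/a. B1 honesty: bookkeeping.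

References: D. Rohrlich, *Compositio Math.* 87 (1993) Prop. 2 [Rohrlich1993Compositio]; H. A. Helfgott,
arXiv:math/0408141 §1 [Helfgott2004RootNumber]; M. Bhargava, W. Ho, arXiv:2207.03309 §1 [BhargavaHo2022].
-/

set_option linter.dupNamespace false
set_option autoImplicit false

noncomputable section

open scoped Classical NumberTheorySymbols

open ZMod WeierstrassCurve
  Literature.NumberTheory.EllipticCurves.BhargavaHo2022
  Summit.BirchSwinnertonDyer.BirchSwinnertonDyer.Theorems.SemistableRootNumber
  Summit.BirchSwinnertonDyer.BirchSwinnertonDyer.Theorems.F2RootNumber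

namespace Summit.BirchSwinnertonDyer.BirchSwinnertonDyer.Theorems.F2RootNumber

/-! ### §1 Elementary Jacobi-symbol bookkeeping -/

/-- If `u² = 1` and `u·x = y` then `x = u·y`. [folklore] -/
private theorem eq_mul_of_sq_eq_one {u x y : ℤ} (hu : u ^ 2 = 1) (h : u * x = y) : x = u * y := by
  subst h
  rw [← mul_assoc, ← sq, hu, one_mul]

/-- A Jacobi symbol satisfies `J³ = J` (its values are `0, ±1`). [folklore] -/
private theorem jacobiSym_pow_three (a : ℤ) (b : ℕ) : J(a | b) ^ 3 = J(a | b) := by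
  rcases jacobiSym.trichotomy a b with h | h | h <;> rw [h] <;> norm_num

/-- `χ₈` of an odd natural number squares to `1`. [folklore] -/
private theorem χ₈_sq_eq_one_of_odd {n : ℕ} (hn : Odd n) : (χ₈ (n : ZMod 8)) ^ 2 = 1 := by
  rw [χ₈_nat_eq_if_mod_eight]
  have h2 : n % 2 = 1 := Nat.odd_iff.mp hn
  rw [if_neg (by omega)]
  split_ifs <;> norm_num

/-- For an integer `c ≡ 1 (mod 8)`, `J(2 | |c|) = 1`. [folklore] -/
private theorem jacobiSym_two_natAbs_eq_one {c : ℤ} (hc : c % 8 = 1) : J(2 | c.natAbs) = 1 := by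
  have hodd : Odd c.natAbs := Int.natAbs_odd.mpr (Int.odd_iff.mpr (by omega))
  have h2 : c.natAbs % 2 = 1 := Nat.odd_iff.mp hodd
  have h : c.natAbs % 8 = 1 ∨ c.natAbs % 8 = 7 := by omega
  rw [jacobiSym.at_two hodd, χ₈_nat_eq_if_mod_eight, if_neg (by omega), if_pos h]

/-- `|a| = sign(a)·a` as an integer identity. [folklore] -/
private theorem natAbs_eq_sign_mul (a : ℤ) : (a.natAbs : ℤ) = a.sign * a :=
  (Int.sign_mul_self_eq_natAbs a).symm

/-- **Jacobi-kernel transfer (abstract form).** Let `c₄, c₆, Δ, G, a₁` be integers with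
`1728·Δ = c₄³ − c₆²`, `c₄ ∣ 8a₁²c₆ − G`, `|Δ| = 2^v·M` with `M` odd, `c₄ ≡ 1 (mod 8)`, `c₆` odd and prime
to `3`, `G` odd and `gcd(a₁, c₄) = 1`. Then three applications of quadratic reciprocity
(`M ↔ |c₆|`, `|c₆| ↔ |c₄|`, `|c₄| ↔ |G|`) turn the Jacobi symbol `J(−c₆ | M)` into `J(c₄ | |G|)` times an
explicit product of reciprocity signs `qrSign`, characters `χ₈`, `J(±1 | ·)` and `J(3 | |c₆|)`. [folklore] -/
theorem jacobiSym_neg_transfer {c₄ c₆ Δ G a₁ : ℤ} {M v : ℕ}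
    (hΔ : 1728 * Δ = c₄ ^ 3 - c₆ ^ 2) (hG : c₄ ∣ 8 * a₁ ^ 2 * c₆ - G)
    (hM : Δ.natAbs = 2 ^ v * M) (hMo : Odd M) (h4 : c₄ % 8 = 1) (h6 : Odd c₆)
    (h63 : ¬ (3 : ℤ) ∣ c₆) (hGo : Odd G) (ha : Int.gcd a₁ c₄ = 1) :
    J(-c₆ | M) =
      J(-c₆.sign | M) * qrSign M c₆.natAbs * (χ₈ c₆.natAbs) ^ v * J(Δ.sign | c₆.natAbs) *
        J(3 | c₆.natAbs) * J(c₄.sign | c₆.natAbs) * qrSign c₆.natAbs c₄.natAbs *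
        J(c₆.sign | c₄.natAbs) * J(G.sign | c₄.natAbs) * qrSign c₄.natAbs G.natAbs *
        J(c₄.sign | G.natAbs) * J(c₄ | G.natAbs) := by
  have hN₆o : Odd c₆.natAbs := Int.natAbs_odd.mpr h6
  have h4o : Odd c₄ := Int.odd_iff.mpr (by omega)
  have hN₄o : Odd c₄.natAbs := Int.natAbs_odd.mpr h4o
  have hNGo : Odd G.natAbs := Int.natAbs_odd.mpr hGo
  -- (1) `−c₆ = (−sign c₆)·|c₆|`
  have e6 : -c₆ = -c₆.sign * (c₆.natAbs : ℤ) := by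
    conv_lhs => rw [← Int.sign_mul_abs c₆, Int.abs_eq_natAbs]
    ring
  have S1 : J(-c₆ | M) = J(-c₆.sign | M) * J((c₆.natAbs : ℤ) | M) := by
    rw [e6, jacobiSym.mul_left]
  -- (2) reciprocity `M ↔ |c₆|`
  have S2 : J((c₆.natAbs : ℤ) | M) = qrSign M c₆.natAbs * J((M : ℤ) | c₆.natAbs) :=
    jacobiSym.quadratic_reciprocity' hN₆o hMo
  -- (3) `M = |Δ|/2^v`: `J(M | |c₆|) = χ₈(|c₆|)^v · J(sign Δ | |c₆|) · J(Δ | |c₆|)`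
  have S3a : J((Δ.natAbs : ℤ) | c₆.natAbs) = (χ₈ c₆.natAbs) ^ v * J((M : ℤ) | c₆.natAbs) := by
    rw [hM]
    push_cast
    rw [jacobiSym.mul_left, jacobiSym.pow_left, jacobiSym.at_two hN₆o]
  have S3b : J((Δ.natAbs : ℤ) | c₆.natAbs) = J(Δ.sign | c₆.natAbs) * J(Δ | c₆.natAbs) := by
    rw [natAbs_eq_sign_mul Δ, jacobiSym.mul_left]
  have S3 : J((M : ℤ) | c₆.natAbs) =
      (χ₈ c₆.natAbs) ^ v * (J(Δ.sign | c₆.natAbs) * J(Δ | c₆.natAbs)) := by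
    refine eq_mul_of_sq_eq_one ?_ (S3a.symm.trans S3b)
    rw [← pow_mul, mul_comm, pow_mul, χ₈_sq_eq_one_of_odd hN₆o, one_pow]
  -- (4) `1728Δ = c₄³ − c₆²`: `J(Δ | |c₆|) = J(3 | |c₆|) · J(c₄ | |c₆|)`
  have e66 : c₄ ^ 3 - c₆ ^ 2 = c₄ ^ 3 + (c₆.natAbs : ℤ) * (-(c₆.natAbs : ℤ)) := by
    rw [← Int.natAbs_sq c₆]
    ring
  have S4a : J(1728 * Δ | c₆.natAbs) = J(c₄ | c₆.natAbs) := by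
    rw [hΔ, e66, jacobiSym.mod_left, Int.add_mul_emod_self_left, ← jacobiSym.mod_left,
      jacobiSym.pow_left, jacobiSym_pow_three]
  have S4b : J(1728 * Δ | c₆.natAbs) = J(3 | c₆.natAbs) * J(Δ | c₆.natAbs) := by
    rw [jacobiSym.mul_left, show (1728 : ℤ) = 4 ^ 3 * 3 ^ 3 by norm_num, jacobiSym.mul_left,
      jacobiSym.pow_left, jacobiSym.pow_left, jacobiSym.at_four hN₆o, one_pow, one_mul,
      jacobiSym_pow_three]
  have h3N : ¬ 3 ∣ c₆.natAbs := fun h ↦ h63 (Int.ofNat_dvd_left.mpr h)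
  have h3sq : J(3 | c₆.natAbs) ^ 2 = 1 := by
    refine jacobiSym.sq_one ?_
    rw [Int.gcd_eq_natAbs, Int.natAbs_natCast]
    exact (Nat.Prime.coprime_iff_not_dvd Nat.prime_three).mpr h3N
  have S4 : J(Δ | c₆.natAbs) = J(3 | c₆.natAbs) * J(c₄ | c₆.natAbs) :=
    eq_mul_of_sq_eq_one h3sq (S4b.symm.trans S4a)
  -- (5) reciprocity `|c₆| ↔ |c₄|`
  have e4 : c₄ = c₄.sign * (c₄.natAbs : ℤ) := by
    conv_lhs => rw [← Int.sign_mul_abs c₄, Int.abs_eq_natAbs]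
  have S5 : J(c₄ | c₆.natAbs) = J(c₄.sign | c₆.natAbs) *
      (qrSign c₆.natAbs c₄.natAbs * J((c₆.natAbs : ℤ) | c₄.natAbs)) := by
    conv_lhs => rw [e4]
    rw [jacobiSym.mul_left, jacobiSym.quadratic_reciprocity' hN₄o hN₆o]
  -- (6) `8a₁²c₆ ≡ G (mod c₄)`: `J(|c₆| | |c₄|) = J(sign c₆ | |c₄|) · J(G | |c₄|)`
  have S6a : J(8 * a₁ ^ 2 * c₆ | c₄.natAbs) = J(G | c₄.natAbs) := by
    apply jacobiSym.mod_left'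
    have hd : (c₄.natAbs : ℤ) ∣ 8 * a₁ ^ 2 * c₆ - G := Int.natAbs_dvd.mpr hG
    exact Int.modEq_iff_dvd.mpr (dvd_sub_comm.mp hd)
  have h2cop : IsCoprime (2 : ℤ) c₄ := by
    obtain ⟨k, hk⟩ := h4o
    exact ⟨-k, 1, by rw [hk]; ring⟩
  have hcop : IsCoprime (2 * a₁) c₄ := IsCoprime.mul_left h2cop (Int.isCoprime_iff_gcd_eq_one.mpr ha)
  have hgcd2 : Int.gcd (2 * a₁) (c₄.natAbs : ℤ) = 1 := by
    rw [Int.gcd_eq_natAbs, Int.natAbs_natCast, ← Int.gcd_eq_natAbs]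
    exact Int.isCoprime_iff_gcd_eq_one.mp hcop
  have S6b : J(8 * a₁ ^ 2 * c₆ | c₄.natAbs) = J(c₆ | c₄.natAbs) := by
    rw [show (8 : ℤ) * a₁ ^ 2 * c₆ = 2 * ((2 * a₁) ^ 2 * c₆) by ring, jacobiSym.mul_left,
      jacobiSym.mul_left, jacobiSym_two_natAbs_eq_one h4, jacobiSym.sq_one' hgcd2, one_mul, one_mul]
  have S6 : J((c₆.natAbs : ℤ) | c₄.natAbs) = J(c₆.sign | c₄.natAbs) * J(G | c₄.natAbs) := by
    rw [natAbs_eq_sign_mul c₆, jacobiSym.mul_left, ← S6b, S6a]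
  -- (7) reciprocity `|c₄| ↔ |G|`
  have eG : G = G.sign * (G.natAbs : ℤ) := by
    conv_lhs => rw [← Int.sign_mul_abs G, Int.abs_eq_natAbs]
  have S7 : J(G | c₄.natAbs) = J(G.sign | c₄.natAbs) *
      (qrSign c₄.natAbs G.natAbs * (J(c₄.sign | G.natAbs) * J(c₄ | G.natAbs))) := by
    conv_lhs => rw [eG]
    rw [jacobiSym.mul_left, jacobiSym.quadratic_reciprocity' hNGo hN₄o, natAbs_eq_sign_mul c₄,
      jacobiSym.mul_left]
  -- assemble
  rw [S1, S2, S3, S4, S5, S6, S7]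
  ring

/-! ### §2 The `F₂` identity `8a₁²c₆ = G + 9c₄(8a₁a₃ − a₁⁴ + 16Q)` and the generic side conditions -/

/-- **`8a₁²·c₆ = G + 9·c₄·(8a₁a₃ − a₁⁴ + 16Q)`** for every `a ∈ ℤ⁴`, with
`G = a₁⁸ − 288a₁⁴Q − 6912a₁²R − 6912Q²`, `Q = a₂² + a₂a₂′ + a₂′²`, `R = a₂a₂′(a₂ + a₂′)`: the value of `c₆` modulo
`c₄` is `G/(8a₁²)` (polynomial division of `8a₁²c₆ − G` by `c₄` in the variable `a₃` is exact over `ℤ`).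
[cite: BhargavaHo2022, §1 (definition of F₂)] -/
theorem eight_mul_a₁_sq_mul_c₆ (a : Params) :
    8 * a.a₁ ^ 2 * a.curveInt.c₆ =
      (a.a₁ ^ 8 - 288 * a.a₁ ^ 4 * (a.a₂ ^ 2 + a.a₂ * a.a₂' + a.a₂' ^ 2)
        - 6912 * a.a₁ ^ 2 * (a.a₂ * a.a₂' * (a.a₂ + a.a₂'))
        - 6912 * (a.a₂ ^ 2 + a.a₂ * a.a₂' + a.a₂' ^ 2) ^ 2) +
      9 * a.curveInt.c₄ * (8 * a.a₁ * a.a₃ - a.a₁ ^ 4 + 16 * (a.a₂ ^ 2 + a.a₂ * a.a₂' + a.a₂' ^ 2)) := by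
  rw [curveInt_c₄, curveInt_c₆]
  ring

/-- For `a₁` odd, `c₄(a) ≡ 1 (mod 8)` (`c₄ = a₁⁴ + 8·(6Q − 3a₁a₃)`, `a₁⁴ ≡ 1 (mod 16)`). [folklore] -/
theorem curveInt_c₄_emod_eight (a : Params) (h1 : Odd a.a₁) : a.curveInt.c₄ % 8 = 1 := by
  obtain ⟨k, hk⟩ := h1
  have h : a.curveInt.c₄ = 1 + 8 * (2 * k ^ 4 + 4 * k ^ 3 + 3 * k ^ 2 + k - 3 * (2 * k + 1) * a.a₃
      + 6 * (a.a₂ ^ 2 + a.a₂ * a.a₂' + a.a₂' ^ 2)) := by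
    rw [curveInt_c₄, hk]
    ring
  rw [h, Int.add_mul_emod_self_left]
  norm_num

/-- For `a₁` odd, `c₆(a)` is odd (`c₆ = −a₁⁶ + 2·(…)`). [folklore] -/
theorem odd_curveInt_c₆ (a : Params) (h1 : Odd a.a₁) : Odd a.curveInt.c₆ := by
  have h : a.curveInt.c₆ = 2 * (18 * a.a₁ ^ 3 * a.a₃ - 36 * a.a₁ ^ 2 * (a.a₂ ^ 2 + a.a₂ * a.a₂' + a.a₂' ^ 2)
      - 108 * a.a₃ ^ 2 - 432 * (a.a₂ * a.a₂' * (a.a₂ + a.a₂'))) - a.a₁ ^ 6 := by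
    rw [curveInt_c₆]
    ring
  rw [h]
  exact (even_two_mul _).sub_odd (h1.pow)

/-- For `3 ∤ a₁`, `3 ∤ c₆(a)` (`c₆ ≡ −a₁⁶ (mod 3)`). [folklore] -/
theorem not_three_dvd_curveInt_c₆ (a : Params) (h3 : ¬ (3 : ℤ) ∣ a.a₁) : ¬ (3 : ℤ) ∣ a.curveInt.c₆ := by
  have h : a.curveInt.c₆ = 3 * (12 * a.a₁ ^ 3 * a.a₃ - 24 * a.a₁ ^ 2 * (a.a₂ ^ 2 + a.a₂ * a.a₂' + a.a₂' ^ 2)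
      - 72 * a.a₃ ^ 2 - 288 * (a.a₂ * a.a₂' * (a.a₂ + a.a₂'))) - a.a₁ ^ 6 := by
    rw [curveInt_c₆]
    ring
  intro hd
  have h6 : (3 : ℤ) ∣ a.a₁ ^ 6 := by
    have := dvd_sub (dvd_mul_right (3 : ℤ) (12 * a.a₁ ^ 3 * a.a₃
      - 24 * a.a₁ ^ 2 * (a.a₂ ^ 2 + a.a₂ * a.a₂' + a.a₂' ^ 2) - 72 * a.a₃ ^ 2
      - 288 * (a.a₂ * a.a₂' * (a.a₂ + a.a₂')))) hd
    rw [h] at this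
    simpa using this
  exact h3 (Int.prime_three.dvd_of_dvd_pow h6)

/-- For `a₁` odd, `G(a₁,a₂,a₂′) = a₁⁸ − 288a₁⁴Q − 6912a₁²R − 6912Q²` is odd. [folklore] -/
theorem odd_G (a : Params) (h1 : Odd a.a₁) :
    Odd (a.a₁ ^ 8 - 288 * a.a₁ ^ 4 * (a.a₂ ^ 2 + a.a₂ * a.a₂' + a.a₂' ^ 2)
        - 6912 * a.a₁ ^ 2 * (a.a₂ * a.a₂' * (a.a₂ + a.a₂'))
        - 6912 * (a.a₂ ^ 2 + a.a₂ * a.a₂' + a.a₂' ^ 2) ^ 2) := by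
  have h : a.a₁ ^ 8 - 288 * a.a₁ ^ 4 * (a.a₂ ^ 2 + a.a₂ * a.a₂' + a.a₂' ^ 2)
        - 6912 * a.a₁ ^ 2 * (a.a₂ * a.a₂' * (a.a₂ + a.a₂'))
        - 6912 * (a.a₂ ^ 2 + a.a₂ * a.a₂' + a.a₂' ^ 2) ^ 2 =
      a.a₁ ^ 8 - 2 * (144 * a.a₁ ^ 4 * (a.a₂ ^ 2 + a.a₂ * a.a₂' + a.a₂' ^ 2)
        + 3456 * a.a₁ ^ 2 * (a.a₂ * a.a₂' * (a.a₂ + a.a₂'))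
        + 3456 * (a.a₂ ^ 2 + a.a₂ * a.a₂' + a.a₂' ^ 2) ^ 2) := by ring
  rw [h]
  exact (h1.pow).sub_even (even_two_mul _)

/-- For `a₁` odd, `3 ∤ a₁` and `gcd(a₁, Q) = 1`: `gcd(a₁, c₄(a)) = 1` (`c₄ = a₁(a₁³ − 24a₃) + 48Q`). [folklore] -/
theorem gcd_a₁_curveInt_c₄ (a : Params) (h1 : Odd a.a₁) (h3 : ¬ (3 : ℤ) ∣ a.a₁)
    (hQ : IsCoprime a.a₁ (a.a₂ ^ 2 + a.a₂ * a.a₂' + a.a₂' ^ 2)) : Int.gcd a.a₁ a.curveInt.c₄ = 1 := by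
  have h2 : IsCoprime a.a₁ 2 := by
    obtain ⟨k, hk⟩ := h1
    exact ⟨1, -k, by rw [hk]; ring⟩
  have h3' : IsCoprime a.a₁ 3 := ((Int.prime_three.coprime_iff_not_dvd).mpr h3).symm
  have h48 : IsCoprime a.a₁ 48 := by
    rw [show (48 : ℤ) = 2 ^ 4 * 3 by norm_num]
    exact (h2.pow_right).mul_right h3'
  have h : a.curveInt.c₄ = 48 * (a.a₂ ^ 2 + a.a₂ * a.a₂' + a.a₂' ^ 2) + a.a₁ * (a.a₁ ^ 3 - 24 * a.a₃) := by
    rw [curveInt_c₄]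
    ring
  rw [h]
  exact Int.isCoprime_iff_gcd_eq_one.mp ((h48.mul_right hQ).add_mul_left_right _)

/-! ### §3 The generic Type-I normal form of the Jacobi kernel of `F₂` -/

/-- **The Jacobi kernel of `F₂` is Type I (generic class).** For `a ∈ ℤ⁴` with `a₁` odd, `3 ∤ a₁`,
`gcd(a₁, Q) = 1` and `|Δ(a)| = 2^v·M` with `M` odd:
`J(−c₆(a) | M) = ε(a) · J(c₄(a) | |G(a₁,a₂,a₂′)|)`, where `G = a₁⁸ − 288a₁⁴Q − 6912a₁²R − 6912Q²` does not
involve `a₃`, `c₄(a) = a₁⁴ + 48Q − 24a₁a₃` is LINEAR in `a₃`, and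
`ε(a) = J(−sgn c₆ | M)·qrSign(M,|c₆|)·χ₈(|c₆|)^v·J(sgn Δ | |c₆|)·J(3 | |c₆|)·J(sgn c₄ | |c₆|)·qrSign(|c₆|,|c₄|)·
J(sgn c₆ | |c₄|)·J(sgn G | |c₄|)·qrSign(|c₄|,|G|)·J(sgn c₄ | |G|)` depends only on signs and on residues of
`M, |c₆|, |c₄|, |G|` modulo `8` and of `|c₆|` modulo `3`. So, for fixed `(a₁,a₂,a₂′)`, `a₃ ↦ J(−c₆(a) | m_a)` is a
real character of modulus `|G|` evaluated at a linear form, times a periodic sign (numerically: period `48` once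
the signs are fixed; kit j281730/j281807). [cite: Helfgott2004RootNumber, §1] [cite: Rohrlich1993Compositio, Prop. 2(ii)] -/
theorem jacobiSym_neg_c₆_eq_typeI (a : Params) {M v : ℕ}
    (hM : a.curveInt.Δ.natAbs = 2 ^ v * M) (hMo : Odd M)
    (h1 : Odd a.a₁) (h3 : ¬ (3 : ℤ) ∣ a.a₁)
    (hQ : IsCoprime a.a₁ (a.a₂ ^ 2 + a.a₂ * a.a₂' + a.a₂' ^ 2)) :
    J(-a.curveInt.c₆ | M) =
      J(-a.curveInt.c₆.sign | M) * qrSign M a.curveInt.c₆.natAbs * (χ₈ a.curveInt.c₆.natAbs) ^ v *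
        J(a.curveInt.Δ.sign | a.curveInt.c₆.natAbs) * J(3 | a.curveInt.c₆.natAbs) *
        J(a.curveInt.c₄.sign | a.curveInt.c₆.natAbs) * qrSign a.curveInt.c₆.natAbs a.curveInt.c₄.natAbs *
        J(a.curveInt.c₆.sign | a.curveInt.c₄.natAbs) *
        J((a.a₁ ^ 8 - 288 * a.a₁ ^ 4 * (a.a₂ ^ 2 + a.a₂ * a.a₂' + a.a₂' ^ 2)
            - 6912 * a.a₁ ^ 2 * (a.a₂ * a.a₂' * (a.a₂ + a.a₂'))
            - 6912 * (a.a₂ ^ 2 + a.a₂ * a.a₂' + a.a₂' ^ 2) ^ 2).sign | a.curveInt.c₄.natAbs) *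
        qrSign a.curveInt.c₄.natAbs
          (a.a₁ ^ 8 - 288 * a.a₁ ^ 4 * (a.a₂ ^ 2 + a.a₂ * a.a₂' + a.a₂' ^ 2)
            - 6912 * a.a₁ ^ 2 * (a.a₂ * a.a₂' * (a.a₂ + a.a₂'))
            - 6912 * (a.a₂ ^ 2 + a.a₂ * a.a₂' + a.a₂' ^ 2) ^ 2).natAbs *
        J(a.curveInt.c₄.sign | (a.a₁ ^ 8 - 288 * a.a₁ ^ 4 * (a.a₂ ^ 2 + a.a₂ * a.a₂' + a.a₂' ^ 2)
            - 6912 * a.a₁ ^ 2 * (a.a₂ * a.a₂' * (a.a₂ + a.a₂'))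
            - 6912 * (a.a₂ ^ 2 + a.a₂ * a.a₂' + a.a₂' ^ 2) ^ 2).natAbs) *
        J(a.curveInt.c₄ | (a.a₁ ^ 8 - 288 * a.a₁ ^ 4 * (a.a₂ ^ 2 + a.a₂ * a.a₂' + a.a₂' ^ 2)
            - 6912 * a.a₁ ^ 2 * (a.a₂ * a.a₂' * (a.a₂ + a.a₂'))
            - 6912 * (a.a₂ ^ 2 + a.a₂ * a.a₂' + a.a₂' ^ 2) ^ 2).natAbs) := by
  refine jacobiSym_neg_transfer a.curveInt.c_relation ⟨9 * (8 * a.a₁ * a.a₃ - a.a₁ ^ 4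
      + 16 * (a.a₂ ^ 2 + a.a₂ * a.a₂' + a.a₂' ^ 2)), ?_⟩ hM hMo (curveInt_c₄_emod_eight a h1)
    (odd_curveInt_c₆ a h1) (not_three_dvd_curveInt_c₆ a h3) (odd_G a h1) (gcd_a₁_curveInt_c₄ a h1 h3 hQ)
  rw [eight_mul_a₁_sq_mul_c₆]
  ring

/-! ### §4 The root number on the squarefree locus (generic class): `w(E_a) = −μ(m)·ε(a)·J(c₄(a) | |G|)` -/

/-- **Type-I normal form of the root number, odd squarefree `Δ`** (generic class `a₁` odd, `3 ∤ a₁`,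
`gcd(a₁, Q) = 1`), modulo the Modularity Theorem: `w(E_a) = −μ(|Δ|)·ε(a)·J(c₄(a) | |G(a₁,a₂,a₂′)|)` with the
explicit sign `ε(a)` of `jacobiSym_neg_c₆_eq_typeI` at `v = 0` — the Möbius function of the discriminant times a
real character of modulus `|G|` (independent of `a₃`) at the linear form `c₄` in `a₃`, times a periodic sign.
[cite: Rohrlich1993Compositio, Prop. 2(ii)] [cite: Helfgott2004RootNumber, §1] -/
theorem rootNumber_curve_eq_typeI_of_odd (a : Params) (hsq : Squarefree a.curveInt.Δ)
    (hodd : ¬ (2 : ℤ) ∣ a.curveInt.Δ) (h1 : Odd a.a₁) (h3 : ¬ (3 : ℤ) ∣ a.a₁)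
    (hQ : IsCoprime a.a₁ (a.a₂ ^ 2 + a.a₂ * a.a₂' + a.a₂' ^ 2))
    (hmod : Literature.NumberTheory.EllipticCurves.ModularForms.exists_isNewformOf) :
    a.curve.rootNumber =
      -(ArithmeticFunction.moebius a.curveInt.Δ.natAbs *
        (J(-a.curveInt.c₆.sign | a.curveInt.Δ.natAbs) * qrSign (a.curveInt.Δ.natAbs) a.curveInt.c₆.natAbs *
          J(a.curveInt.Δ.sign | a.curveInt.c₆.natAbs) * J(3 | a.curveInt.c₆.natAbs) *
          J(a.curveInt.c₄.sign | a.curveInt.c₆.natAbs) * qrSign a.curveInt.c₆.natAbs a.curveInt.c₄.natAbs *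
          J(a.curveInt.c₆.sign | a.curveInt.c₄.natAbs) *
          J((a.a₁ ^ 8 - 288 * a.a₁ ^ 4 * (a.a₂ ^ 2 + a.a₂ * a.a₂' + a.a₂' ^ 2)
            - 6912 * a.a₁ ^ 2 * (a.a₂ * a.a₂' * (a.a₂ + a.a₂'))
            - 6912 * (a.a₂ ^ 2 + a.a₂ * a.a₂' + a.a₂' ^ 2) ^ 2).sign | a.curveInt.c₄.natAbs) *
          qrSign a.curveInt.c₄.natAbs
            (a.a₁ ^ 8 - 288 * a.a₁ ^ 4 * (a.a₂ ^ 2 + a.a₂ * a.a₂' + a.a₂' ^ 2)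
            - 6912 * a.a₁ ^ 2 * (a.a₂ * a.a₂' * (a.a₂ + a.a₂'))
            - 6912 * (a.a₂ ^ 2 + a.a₂ * a.a₂' + a.a₂' ^ 2) ^ 2).natAbs *
          J(a.curveInt.c₄.sign | (a.a₁ ^ 8 - 288 * a.a₁ ^ 4 * (a.a₂ ^ 2 + a.a₂ * a.a₂' + a.a₂' ^ 2)
            - 6912 * a.a₁ ^ 2 * (a.a₂ * a.a₂' * (a.a₂ + a.a₂'))
            - 6912 * (a.a₂ ^ 2 + a.a₂ * a.a₂' + a.a₂' ^ 2) ^ 2).natAbs) *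
          J(a.curveInt.c₄ | (a.a₁ ^ 8 - 288 * a.a₁ ^ 4 * (a.a₂ ^ 2 + a.a₂ * a.a₂' + a.a₂' ^ 2)
            - 6912 * a.a₁ ^ 2 * (a.a₂ * a.a₂' * (a.a₂ + a.a₂'))
            - 6912 * (a.a₂ ^ 2 + a.a₂ * a.a₂' + a.a₂' ^ 2) ^ 2).natAbs))) := by
  have hMo : Odd a.curveInt.Δ.natAbs := Int.natAbs_odd.mpr (Int.odd_iff.mpr (by omega))
  have h := jacobiSym_neg_c₆_eq_typeI a (M := a.curveInt.Δ.natAbs) (v := 0) (by simp) hMo h1 h3 hQ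
  rw [pow_zero, mul_one] at h
  rw [rootNumber_curve_eq_neg_moebius_mul_jacobiSym_of_odd a hsq hodd hmod, h]

/-- **Type-I normal form of the root number, even squarefree `Δ`** (`2 ∥ Δ`; generic class), modulo
Modularity: with `m = |Δ|/2` (odd), `w(E_a) = −μ(m)·ε(a)·J(c₄(a) | |G(a₁,a₂,a₂′)|)`, `ε(a)` the explicit sign of
`jacobiSym_neg_c₆_eq_typeI` at `v = 1` (one factor `χ₈(|c₆|)`).
[cite: Rohrlich1993Compositio, Prop. 2(ii)] [cite: Helfgott2004RootNumber, §1] -/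
theorem rootNumber_curve_eq_typeI_of_even (a : Params) (hsq : Squarefree a.curveInt.Δ)
    (heven : (2 : ℤ) ∣ a.curveInt.Δ) (h1 : Odd a.a₁) (h3 : ¬ (3 : ℤ) ∣ a.a₁)
    (hQ : IsCoprime a.a₁ (a.a₂ ^ 2 + a.a₂ * a.a₂' + a.a₂' ^ 2))
    (hmod : Literature.NumberTheory.EllipticCurves.ModularForms.exists_isNewformOf) :
    a.curve.rootNumber =
      -(ArithmeticFunction.moebius (a.curveInt.Δ.natAbs / 2) *
        (J(-a.curveInt.c₆.sign | a.curveInt.Δ.natAbs / 2) * qrSign (a.curveInt.Δ.natAbs / 2) a.curveInt.c₆.natAbs * χ₈ a.curveInt.c₆.natAbs *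
          J(a.curveInt.Δ.sign | a.curveInt.c₆.natAbs) * J(3 | a.curveInt.c₆.natAbs) *
          J(a.curveInt.c₄.sign | a.curveInt.c₆.natAbs) * qrSign a.curveInt.c₆.natAbs a.curveInt.c₄.natAbs *
          J(a.curveInt.c₆.sign | a.curveInt.c₄.natAbs) *
          J((a.a₁ ^ 8 - 288 * a.a₁ ^ 4 * (a.a₂ ^ 2 + a.a₂ * a.a₂' + a.a₂' ^ 2)
            - 6912 * a.a₁ ^ 2 * (a.a₂ * a.a₂' * (a.a₂ + a.a₂'))
            - 6912 * (a.a₂ ^ 2 + a.a₂ * a.a₂' + a.a₂' ^ 2) ^ 2).sign | a.curveInt.c₄.natAbs) *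
          qrSign a.curveInt.c₄.natAbs
            (a.a₁ ^ 8 - 288 * a.a₁ ^ 4 * (a.a₂ ^ 2 + a.a₂ * a.a₂' + a.a₂' ^ 2)
            - 6912 * a.a₁ ^ 2 * (a.a₂ * a.a₂' * (a.a₂ + a.a₂'))
            - 6912 * (a.a₂ ^ 2 + a.a₂ * a.a₂' + a.a₂' ^ 2) ^ 2).natAbs *
          J(a.curveInt.c₄.sign | (a.a₁ ^ 8 - 288 * a.a₁ ^ 4 * (a.a₂ ^ 2 + a.a₂ * a.a₂' + a.a₂' ^ 2)
            - 6912 * a.a₁ ^ 2 * (a.a₂ * a.a₂' * (a.a₂ + a.a₂'))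
            - 6912 * (a.a₂ ^ 2 + a.a₂ * a.a₂' + a.a₂' ^ 2) ^ 2).natAbs) *
          J(a.curveInt.c₄ | (a.a₁ ^ 8 - 288 * a.a₁ ^ 4 * (a.a₂ ^ 2 + a.a₂ * a.a₂' + a.a₂' ^ 2)
            - 6912 * a.a₁ ^ 2 * (a.a₂ * a.a₂' * (a.a₂ + a.a₂'))
            - 6912 * (a.a₂ ^ 2 + a.a₂ * a.a₂' + a.a₂' ^ 2) ^ 2).natAbs))) := by
  obtain ⟨M, hM⟩ : 2 ∣ a.curveInt.Δ.natAbs := Int.natCast_dvd.mp heven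
  have hdiv : a.curveInt.Δ.natAbs / 2 = M := by rw [hM]; simp
  have hMo : Odd M := by
    refine Nat.odd_iff.mpr (Nat.two_dvd_ne_zero.mp fun h2 ↦ ?_)
    obtain ⟨k, hk⟩ := h2
    have h4 : (2 : ℤ) * 2 ∣ a.curveInt.Δ := by
      refine Int.natAbs_dvd_natAbs.mp ?_
      exact ⟨k, by rw [hM, hk]; simp; ring⟩
    exact Int.prime_two.not_unit (hsq 2 h4)
  have h := jacobiSym_neg_c₆_eq_typeI a (M := M) (v := 1) (by rw [hM, pow_one]) hMo h1 h3 hQ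
  rw [pow_one] at h
  rw [rootNumber_curve_eq_neg_moebius_mul_jacobiSym_of_even a hsq heven hmod, hdiv, h]

end Summit.BirchSwinnertonDyer.BirchSwinnertonDyer.Theorems.F2RootNumber

end
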